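import Mathlib
import Summits.Ventures.PercRepro2.VdBKahn
import Summits.Ventures.PercRepro2.CrossAPrimeA2Route

/-!
# The crux in cell form, and the v-marked van den Berg–Kahn inequality for the cluster of `a₁`
(blind cell PercRepro2, p5 g40; S4 §2.4 (s) addendum 53)

Two things, both in the vocabulary of `CrossAPrimeA2Route` / `VdBKahn`.

1. **The cell form of the crux functional.**  With the six masses of `crossC` (`Z = P(Q)`,
   `x = P(Q, o ∈ K)`, `y = P(Q, b ∈ K)`, `xv`, `yv`, `Dv`, `Q = {a₂ ↮ a₁}`, `K = C(a₂)`),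
   `crossC p c = c·x·y + Dv·(2Z − x − y) − x·(yv − Dv) − y·(xv − Dv)` (`crossC_eq_cells`): the
   `a₁ ↔ v` mass of the marks-free cell never enters, the negative mass is the split product, and
   `0 ≤ crossC` is the inequality `c·(x − t)(y − t) ≤ c·t² + Dv·(2Z − x − y) + x·S_b + y·S_o`
   with `t = P(Q, o, b ∈ K)` and the admissibility slacks `S_b = c(y − t) − (yv − Dv)`,
   `S_o = c(x − t) − (xv − Dv)` (`crossC_nonneg_iff_cells`).

2. **The v-marked vdB–Kahn inequality** (the cell's candidate of record for the small-coin limit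
   of the crux — addendum 53 (2)–(3); NOT a theorem, a `Prop`): for the cluster `A` of `a₁` and
   marks `v, o, b`, with `R_X = {a₁ ↮ x ∀ x ∈ X}` and `L = {a₁ ↔ v}`,

     `P(R_o)·P(R_b ∩ L) + P(R_b)·P(R_o ∩ L) ≤ P(L)·P(R_{o,b}) + P(R_{o,b} ∩ L)`   (`VMarkedVdBK`),

   the vdB–Kahn inequality `P(b ∈ A, o ∉ A)·P(o ∈ A, b ∉ A) ≤ P(o, b ∉ A)·P(o, b ∈ A)` weighted
   by the number of v-marks of the pair of clusters; and its cubic cousin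
   `P(R_o)·P(R_b ∩ L) + P(R_b)·P(R_o ∩ L) ≤ P(L)·P(R_o)·P(R_b) + 2·P(R_{o,b} ∩ L)`
   (`VMarkedCubic`), which is the small-coin limit of the crux on the class where `o` and `b`
   cannot be joined avoiding `a₁`.  What the tree proves: the KNOWN bound with coefficient 2,
   each cross product `≤ P(L)·P(R_{o,b})` (van den Berg–Kahn, `vdBK`; `vMarked_cross_le`,
   `vMarked_le_two_mul`), and the degenerate instances `o = b` (`vMarkedVdBK_of_eq`), `v = a₁`
   (`vMarkedVdBK_of_v_eq`) and `v = o` (`vMarkedVdBK_of_v_eq_o`).  Nothing here claims the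
   conjectures.  Own work; standard axioms.
-/

namespace Summit.Ventures.PercRepro2

open CrossAPrimeA2Route

namespace CrossAPrimeVMarked

section Cells

variable {V : Type*} {E : Type*} [Fintype E] [DecidableEq E] {R : Type*} [Field R]

/-- **The cell form of `crossC`**: `crossC p c = c·x·y + Dv·(2Z − x − y) − x·(yv − Dv) − y·(xv − Dv)`. -/
theorem crossC_eq_cells (p : E → R) (c : R) (ends : E → Sym2 V) (o a₁ a₂ v b : V) :
    crossC p c ends o a₁ a₂ v b =
      c * prob p (avoidAll ends a₂ {a₁} ∩ connEvent ends a₂ o) *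
          prob p (avoidAll ends a₂ {a₁} ∩ connEvent ends a₂ b) +
        prob p (avoidAll ends a₂ {a₁} ∩
            (connEvent ends a₁ v ∩ (connEvent ends a₂ o ∩ connEvent ends a₂ b))) *
          (2 * prob p (avoidAll ends a₂ {a₁}) -
            prob p (avoidAll ends a₂ {a₁} ∩ connEvent ends a₂ o) -
            prob p (avoidAll ends a₂ {a₁} ∩ connEvent ends a₂ b)) -
        prob p (avoidAll ends a₂ {a₁} ∩ connEvent ends a₂ o) *
          (prob p (avoidAll ends a₂ {a₁} ∩ (connEvent ends a₁ v ∩ connEvent ends a₂ b)) -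
            prob p (avoidAll ends a₂ {a₁} ∩
              (connEvent ends a₁ v ∩ (connEvent ends a₂ o ∩ connEvent ends a₂ b)))) -
        prob p (avoidAll ends a₂ {a₁} ∩ connEvent ends a₂ b) *
          (prob p (avoidAll ends a₂ {a₁} ∩ (connEvent ends a₁ v ∩ connEvent ends a₂ o)) -
            prob p (avoidAll ends a₂ {a₁} ∩
              (connEvent ends a₁ v ∩ (connEvent ends a₂ o ∩ connEvent ends a₂ b)))) := by
  unfold crossC
  ring

/-- **`0 ≤ crossC` in cell form**: with `t = P(Q, o, b ∈ K)` and the admissibility slacks of the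
single-mark cells `S_b = c·(y − t) − (yv − Dv)`, `S_o = c·(x − t) − (xv − Dv)`,
`0 ≤ crossC ↔ c·(x − t)·(y − t) ≤ c·t² + Dv·(2Z − x − y) + x·S_b + y·S_o`. -/
theorem crossC_nonneg_iff_cells [LinearOrder R] [IsStrictOrderedRing R] (p : E → R) (c : R)
    (ends : E → Sym2 V) (o a₁ a₂ v b : V) (t : R)
    (ht : t = prob p (avoidAll ends a₂ {a₁} ∩ (connEvent ends a₂ o ∩ connEvent ends a₂ b))) :
    0 ≤ crossC p c ends o a₁ a₂ v b ↔
      c * (prob p (avoidAll ends a₂ {a₁} ∩ connEvent ends a₂ o) - t) *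
          (prob p (avoidAll ends a₂ {a₁} ∩ connEvent ends a₂ b) - t) ≤
        c * t ^ 2 +
          prob p (avoidAll ends a₂ {a₁} ∩
              (connEvent ends a₁ v ∩ (connEvent ends a₂ o ∩ connEvent ends a₂ b))) *
            (2 * prob p (avoidAll ends a₂ {a₁}) -
              prob p (avoidAll ends a₂ {a₁} ∩ connEvent ends a₂ o) -
              prob p (avoidAll ends a₂ {a₁} ∩ connEvent ends a₂ b)) +
          prob p (avoidAll ends a₂ {a₁} ∩ connEvent ends a₂ o) *
            (c * (prob p (avoidAll ends a₂ {a₁} ∩ connEvent ends a₂ b) - t) -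
              (prob p (avoidAll ends a₂ {a₁} ∩ (connEvent ends a₁ v ∩ connEvent ends a₂ b)) -
                prob p (avoidAll ends a₂ {a₁} ∩
                  (connEvent ends a₁ v ∩ (connEvent ends a₂ o ∩ connEvent ends a₂ b))))) +
          prob p (avoidAll ends a₂ {a₁} ∩ connEvent ends a₂ b) *
            (c * (prob p (avoidAll ends a₂ {a₁} ∩ connEvent ends a₂ o) - t) -
              (prob p (avoidAll ends a₂ {a₁} ∩ (connEvent ends a₁ v ∩ connEvent ends a₂ o)) -
                prob p (avoidAll ends a₂ {a₁} ∩
                  (connEvent ends a₁ v ∩ (connEvent ends a₂ o ∩ connEvent ends a₂ b))))) := by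
  subst ht
  rw [crossC_eq_cells]
  constructor <;> intro h <;> nlinarith [h]

end Cells

section VMarked

variable {V : Type*} {E : Type*} [Fintype E] [DecidableEq E] [Fintype V] [DecidableEq V]
  {R : Type*} [Field R] [LinearOrder R] [IsStrictOrderedRing R]

/-- **The v-marked vdB–Kahn inequality at one instance** (a `Prop`, NOT a theorem): for the
cluster `A` of `a₁`, `P(o ∉ A)·P(b ∉ A, v ∈ A) + P(b ∉ A)·P(o ∉ A, v ∈ A)
≤ P(v ∈ A)·P(o, b ∉ A) + P(o, b ∉ A, v ∈ A)`. -/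
def VMarkedVdBK (p : E → R) (ends : E → Sym2 V) (a₁ v o b : V) : Prop :=
  prob p (avoidAll ends a₁ {o}) * prob p (avoidAll ends a₁ {b} ∩ connEvent ends a₁ v) +
      prob p (avoidAll ends a₁ {b}) * prob p (avoidAll ends a₁ {o} ∩ connEvent ends a₁ v) ≤
    prob p (connEvent ends a₁ v) * prob p (avoidAll ends a₁ {o, b}) +
      prob p (avoidAll ends a₁ {o, b} ∩ connEvent ends a₁ v)

/-- **The cubic cousin** (the small-coin limit of the crux on the class where `o` and `b` cannot
be joined avoiding `a₁`; a `Prop`, NOT a theorem): `P(o ∉ A)·P(b ∉ A, v ∈ A) +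
P(b ∉ A)·P(o ∉ A, v ∈ A) ≤ P(v ∈ A)·P(o ∉ A)·P(b ∉ A) + 2·P(o, b ∉ A, v ∈ A)`. -/
def VMarkedCubic (p : E → R) (ends : E → Sym2 V) (a₁ v o b : V) : Prop :=
  prob p (avoidAll ends a₁ {o}) * prob p (avoidAll ends a₁ {b} ∩ connEvent ends a₁ v) +
      prob p (avoidAll ends a₁ {b}) * prob p (avoidAll ends a₁ {o} ∩ connEvent ends a₁ v) ≤
    prob p (connEvent ends a₁ v) * prob p (avoidAll ends a₁ {o}) * prob p (avoidAll ends a₁ {b}) +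
      2 * prob p (avoidAll ends a₁ {o, b} ∩ connEvent ends a₁ v)

omit [Fintype E] [DecidableEq E] [Fintype V] [DecidableEq V] in
/-- `avoidAll` for a singleton is the complement of the connection event. -/
lemma avoidAll_singleton (ends : E → Sym2 V) (s x : V) :
    avoidAll ends s {x} = (connEvent ends s x)ᶜ := by
  ext ω
  simp [avoidAll, connEvent]

omit [Fintype E] [DecidableEq E] [Fintype V] in
/-- `avoidAll` for a pair is the intersection of the two singleton avoidances. -/
lemma avoidAll_pair (ends : E → Sym2 V) (s x y : V) :
    avoidAll ends s {x, y} = avoidAll ends s {x} ∩ avoidAll ends s {y} := by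
  ext ω
  simp only [avoidAll, Set.mem_setOf_eq, Set.mem_inter_iff, Finset.mem_insert, Finset.mem_singleton]
  constructor
  · intro h
    exact ⟨fun z hz => h z (Or.inl hz), fun z hz => h z (Or.inr hz)⟩
  · rintro ⟨h₁, h₂⟩ z hz
    rcases hz with hz | hz
    · exact h₁ z hz
    · exact h₂ z hz

omit [Fintype E] [DecidableEq E] [Fintype V] [DecidableEq V] in
/-- The avoidance events are decreasing. -/
lemma isLowerSet_avoidAll (ends : E → Sym2 V) (s : V) (X : Finset V) :
    IsLowerSet (avoidAll ends s X) := by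
  intro ω ω' h hω y hy hc
  exact hω y hy (conn_mono h hc)

/-- **The known bound (van den Berg–Kahn)**: each cross product is at most
`P(v ∈ A)·P(o, b ∉ A)`. -/
theorem vMarked_cross_le {p : E → R} (hp : IsProbVec p) (ends : E → Sym2 V) (a₁ v o b : V)
    (hob : o ≠ b) :
    prob p (avoidAll ends a₁ {o}) * prob p (avoidAll ends a₁ {b} ∩ connEvent ends a₁ v) ≤
      prob p (connEvent ends a₁ v) * prob p (avoidAll ends a₁ {o, b}) := by
  have h := vdBK p hp ends a₁ ∅ {v} {o} {b}
  have e0 : connAll ends a₁ ∅ = Set.univ := by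
    ext ω; simp [connAll]
  have e1 : connAll ends a₁ {v} = connEvent ends a₁ v := by
    ext ω; simp [connAll, connEvent]
  have e2 : ({o} : Finset V) ∩ {b} = ∅ := by
    ext z; simp [hob]
  have e3 : avoidAll ends a₁ (∅ : Finset V) = Set.univ := by
    ext ω; simp [avoidAll]
  have e4 : ({o} : Finset V) ∪ {b} = {o, b} := by
    ext z; simp
  simp only [e0, e2, e3, e4, Finset.empty_union, e1, Set.univ_inter, Set.inter_univ] at h
  rw [Set.inter_comm (connEvent ends a₁ v) (avoidAll ends a₁ {b})] at h
  exact h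

/-- **The bound with coefficient 2**: the left-hand side of `VMarkedVdBK` is at most
`2·P(v ∈ A)·P(o, b ∉ A)` — the Ahlswede–Daykin cone; `VMarkedVdBK` asks for the sharper
right-hand side `P(v ∈ A)·P(o, b ∉ A) + P(o, b ∉ A, v ∈ A)`. -/
theorem vMarked_le_two_mul {p : E → R} (hp : IsProbVec p) (ends : E → Sym2 V) (a₁ v o b : V)
    (hob : o ≠ b) :
    prob p (avoidAll ends a₁ {o}) * prob p (avoidAll ends a₁ {b} ∩ connEvent ends a₁ v) +
        prob p (avoidAll ends a₁ {b}) * prob p (avoidAll ends a₁ {o} ∩ connEvent ends a₁ v) ≤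
      2 * (prob p (connEvent ends a₁ v) * prob p (avoidAll ends a₁ {o, b})) := by
  have h1 := vMarked_cross_le hp ends a₁ v o b hob
  have h2 := vMarked_cross_le hp ends a₁ v b o hob.symm
  have e : ({b, o} : Finset V) = {o, b} := Finset.pair_comm b o
  rw [e] at h2
  linarith

omit [Fintype V] in
/-- The degenerate instance `o = b`: `VMarkedVdBK` holds. -/
theorem vMarkedVdBK_of_eq {p : E → R} (hp : IsProbVec p) (ends : E → Sym2 V) (a₁ v o : V) :
    VMarkedVdBK p ends a₁ v o o := by
  unfold VMarkedVdBK
  have e : ({o, o} : Finset V) = {o} := by simp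
  rw [e]
  have h1 : prob p (avoidAll ends a₁ {o} ∩ connEvent ends a₁ v) ≤ prob p (connEvent ends a₁ v) :=
    prob_mono hp Set.inter_subset_right
  have h2 := prob_le_one hp (avoidAll ends a₁ {o})
  have h3 := prob_nonneg hp (avoidAll ends a₁ {o})
  have h4 := prob_nonneg hp (avoidAll ends a₁ {o} ∩ connEvent ends a₁ v)
  nlinarith [mul_le_mul_of_nonneg_left h1 h3, mul_le_mul_of_nonneg_right h2 h4]

omit [Fintype V] in
/-- The degenerate instance `v = a₁` (then `L` is the sure event and the statement is Harris for
the two avoidances): `VMarkedVdBK` holds. -/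
theorem vMarkedVdBK_of_v_eq {p : E → R} (hp : IsProbVec p) (ends : E → Sym2 V) (a₁ o b : V) :
    VMarkedVdBK p ends a₁ a₁ o b := by
  unfold VMarkedVdBK
  have eL : connEvent ends a₁ a₁ = Set.univ := by
    ext ω; simp [connEvent, conn_refl]
  simp only [eL, Set.inter_univ, prob_univ, one_mul, avoidAll_pair]
  have h := prob_mul_prob_le_prob_inter_of_isLowerSet hp (isLowerSet_avoidAll ends a₁ {o})
    (isLowerSet_avoidAll ends a₁ {b})
  linarith [mul_comm (prob p (avoidAll ends a₁ {o})) (prob p (avoidAll ends a₁ {b}))]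

/-- The degenerate instance `v = o` (the `R_o ∩ L` masses vanish and the statement is the
van den Berg–Kahn bound): `VMarkedVdBK` holds. -/
theorem vMarkedVdBK_of_v_eq_o {p : E → R} (hp : IsProbVec p) (ends : E → Sym2 V) (a₁ o b : V)
    (hob : o ≠ b) :
    VMarkedVdBK p ends a₁ o o b := by
  unfold VMarkedVdBK
  have e1 : avoidAll ends a₁ {o} ∩ connEvent ends a₁ o = ∅ := by
    ext ω
    simp [avoidAll_singleton]
  have e2 : avoidAll ends a₁ {o, b} ∩ connEvent ends a₁ o = ∅ := by
    ext ω
    simp only [Set.mem_inter_iff, Set.mem_empty_iff_false, iff_false, not_and]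
    intro h1 h2
    exact h1 o (Finset.mem_insert_self o {b}) h2
  rw [e1, e2, prob_empty, mul_zero, add_zero, add_zero]
  exact vMarked_cross_le hp ends a₁ o o b hob

end VMarked

end CrossAPrimeVMarked

end Summit.Ventures.PercRepro2
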